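import Summits.QuantumFields.YangMills.Theorems.BalabanUVNodesN11NodeFacesOfSupplyChainTokensOperandRoads
import Literature.MathematicalPhysics.QuantumFieldTheory.Balaban1983to89.Node00.Record13NumericsOfThm1CCMZ

/-!
# DAG node N11 — THE STEP-WINDOW TOKEN SOCKETS AT THE z-WITNESS FAMILIES (FLAG №9 (4) re-key by token-pass, OWN lineage): N11's node ∕ `B16.Thm1Printed` ∕ the
# `h11`-shaped (S1ᵀ) family from `hN : ∀ P, Step.InInterval γ′ P.K (gOfRecord₁₃ θ P) → SupplyChainAt θ P` at ANY H-extension of DEF-1's all-numerics z-witness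
# `θ₁₃ᶻ(n, ε₂₉; Efl, logz) = theta13LiveOfNumericsZ …`, of the windowed collared z-witness `θ₁₅ᶜᶜᴹᵂᶻ(j; γ; Efl, logz) = theta13OfThm1CCMWZ …` (window `0 < γ ≤ ½` + six
# signs ONLY — the letters `Efl`, `logz` are NOT read), and at the certificate `θᴳᶻ := gaussPinH (ofHistoryBlind ⟨θ₁₅ᶜᶜᴹᵂᶻ, Zr⟩)` (token family ∕ continuity road ∕ operand-rows road)

HEADER — WORK-UNIT METADATA.  Cell `pub-ymgap`, YM-PLAN Track A (HUMAN RULING D-0062 ∕ D-0149 width seats), seat `pub-ymgap-dag-n11-w1` (g5; WIDTH SEAT 1 of 4 on NODE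
n11 [B14]), route `BalabanUVNodes` rev 29, KEY item K1⁹ `StabilityBRunRowsAtRecordR13SepCoPHV` = stmt-QuantumFields-27364 (dag-lead KEY MAP v2; helper lane, `--kind proof
--supports 27364 --as helper`, count-neutral; seat payload key K1⁷ 20542 = MIS-KEY fallback).  [III] = [Balaban1988Convergent], [V] = [Balaban1989LargeFieldII], [IV] =
[Balaban1989LargeFieldI], [I] = [Balaban1987RG1].  Over this seat's `…N11NodeFacesOfSupplyChainTokensAtWitness` (g4 FILE 3: the live-re-pin sockets
`b14_main_leavesP_all_liveRepinH_of_supplyChainAt_family` ∕ `thm1Printed_datumOfRecord₁₃CoPH_liveRepinH_…` ∕ `h11Family_liveRepinH_…`), `…N11NodeFacesOfSupplyChainTokens` (g4 FILE 2: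
`supplyChainAt_family_of_gaussCert_of_continuous`), `…OperandRoads` (g4 FILE 4: `supplyChainAt_family_of_gaussCert_of_operandRows`), this seat's `…GaussianCertificateDefs`
(`gaussPinH`, `gaussPinH_ζ0 ∕ _quad`), dag-n11-w6's `…N11K1WitnessGaussPinH` (the certificate shape `gaussPinH (Stage13HParams.ofHistoryBlind F N ⟨·, Zr⟩)`), and ym-nodeO DEF-1 g9's
Z2 `Node00/Record13NumericsOfThm1CCMZ` (`theta13OfNumericsZ`, `theta13LiveOfNumericsZ`, `theta13OfThm1CCMWZ`, `admissible_theta13OfNumericsZ`, the `rfl` bridges `…_eq_Z`).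

WHY THIS FILE.  Director-ym №218 ∕ FLAG №9: K1's witness of record `θ₁₅ᶜᶜᴹᵂ(j; γ)` is COUPLING-BLIND (its fluctuation letters `E_k`, `log z_k` are pinned to `0`); the z-WITNESS
EDITION (Z1 p637981 ✓ + Z2 p639492 ✓) carries them as OPEN LETTERS `Efl logz : B12.RunParams → ℕ → ℝ`, and №218 (3)∕(4) asks every consumer to RE-KEY its own door-keyed faces at the
z-witness BY TOKEN-PASS («one declarer per OWN file»).  This seat's g4 FILE 3 §2–§4 and FILE 4 §4 are N11's K1-road faces keyed at `theta13LiveOfNumerics` ∕ `theta13OfThm1CCMW` ∕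
`θᴳ`; THIS FILE is their Z edition — the SAME one-line compositions through FILE 3 §1's θ-generic live-re-pin sockets, because `θ₁₃ᶻ(n, ε₂₉; Efl, logz) = (theta13OfNumericsZ …).liveRepin₁₃`
(`rfl`) is admissible from `n.Pos ∧ 0 < ε₂₉` WHATEVER THE LETTERS (Z2 `admissible_theta13OfNumericsZ`), its §2 numerics ∕ window ∕ block size are `n`'s (`rfl`), and
`θ₁₅ᶜᶜᴹᵂᶻ(j; γ; Efl, logz)` is the member at `n := stage12NumericsOfThm1CCMW F.L j γ ε₀ B₃ B₃' a₀ a₁` (`rfl`) — so the window `0 < γ ≤ ½` and the six signs of the BLIND edition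
serve verbatim (`stage12NumericsOfThm1CCMW_pos_of_le_half`, numerals `κ = 2·10⁴`, `E₀ = B₀ = 1`, `M = L^j ≥ 1`).  dag-n24-c g12 HOURLY-1 (I.39012): «(N11) `h11` … n11-w1 p634326
`h11Family_liveRepinH_…` is θ-GENERIC ⇒ instantiates at Z» — these are the named instances.  (§4) records that the blind faces ARE the `(0, 0)` members (`rfl`).

WHAT THIS FILE PROVES (11 theorems, 0 `def`, 0 `sorry`; standard axioms; compositions BY NAME + `rfl`).
§1 (any H-extension of `θ₁₃ᶻ(n, ε₂₉; Efl, logz)`) ★ `b14_main_leavesP_all_theta13LiveOfNumericsZH_of_supplyChainAt_family` · ★ `thm1Printed_datumOfRecord₁₃CoPH_theta13LiveOfNumericsZH_of_supplyChainAt_family` ·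
   ★★ `h11Family_theta13LiveOfNumericsZH_of_supplyChainAt_family`.
§2 (any H-extension of `θ₁₅ᶜᶜᴹᵂᶻ(j; γ; Efl, logz)`) ★ `b14_main_leavesP_all_theta13OfThm1CCMWZH_of_supplyChainAt_family` · ★ `thm1Printed_datumOfRecord₁₃CoPH_theta13OfThm1CCMWZH_of_supplyChainAt_family` ·
   ★★ `h11Family_theta13OfThm1CCMWZH_of_supplyChainAt_family`.
§3 (`θᴳᶻ := gaussPinH (ofHistoryBlind ⟨θ₁₅ᶜᶜᴹᵂᶻ, Zr⟩)`) ★★★ `h11Family_gaussPinH_ofHistoryBlind_theta13OfThm1CCMWZ_of_supplyChainAt_family` · ★★★ `…_of_continuous` (CONTINUITY road) ·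
   ★★ `b14_main_leavesP_all_gaussPinH_ofHistoryBlind_theta13OfThm1CCMWZ_of_continuous` · ★★★ `h11Family_gaussPinH_ofHistoryBlind_theta13OfThm1CCMWZ_of_operandRows_windowed` (OPERAND-ROWS road).
§4 (`rfl` bridge) `gaussPinH_ofHistoryBlind_theta13OfThm1CCMW_eq_Z` — dag-n11-w6's `θᴳ` IS the `(0, 0)` member `θᴳᶻ(…; 0, 0)`.

HONEST FRAMING.  Helper lane of K1⁹; count-neutral KERNEL COMPOSITION of landed theorems at a DEFINITION EDITION; `SupplierObligations` ([III] §3 ∕ Thm 2 proper — XL, nobody's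
theorem), the continuity∕bound rows, def-T's operand rows, the certificate door `hG`∕`hrec` are DISPLAYED HYPOTHESES; NO value of `E_k ∕ log z_k` pinned or read; NOT a claim that
`θ₁₅ᶜᶜᴹᵂᶻ` is K1⁹'s witness; FLAG №9 NOT closed by this (№218 (4): N13 delivers `(E_k, log z_k)`); nothing of Bałaban asserted.  No v10 stub touched; K1⁹ NOT closed; N11 NOT
discharged; counts unmoved (typed 28∕28 · discharged 5∕27 · A 5∕28).  One finite `𝕋⁴_{L^K}` programme at fixed `ε = L^{−K}`; R4 closes only the conditional finite-𝕋⁴ rung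
`BalabanLadder.UV` — NOT ℝ⁴, NOT OS, NOT a mass gap, NOT Clay.  No `sorry`, `axiom`, `def`, `instance`, `notation`.
Sources (SHAPE ∕ bookkeeping only): [III] Thm 1 p.262, Theorem p.245, remark p.262, p.244 L36–38, §3 p.279, (1.15) p.249, (2.4) p.255, (2.10) p.256, (3.16)–(3.25) pp.268–270;
[V] Thm 1 + (0.1) pp.355–356, (0.15) p.360; [IV] (0.3)–(0.4) p.176, p.177 (i)–(ii); [I] Thm 1 p.259, (0.20) p.256.
-/

noncomputable section

open MeasureTheory TopologicalSpace
open scoped BigOperators ENNReal NNReal Matrix.Norms.L2Operator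

namespace Summit.QuantumFields.YangMills.Theorems.BalabanUVNodesN11NodeFacesOfSupplyChainTokensAtZWitness

open Literature.MathematicalPhysics.QuantumFieldTheory.Balaban1983to89 T4Continuum T4NestedCovariance Node00 Node00.Tk DagBinding
open B15DeterminingSets B8Eq17ClassAkV1 B14.Eq218Concrete B10Eq42TorusConstraint Step
open BalabanUVNodesN11HistoryPinnedResidualDefs BalabanUVNodesN11RePinnedParamDefs
open BalabanUVNodesN11GaussianCertificateDefs (gaussPinH gaussPinH_ζ0 gaussPinH_quad provisos₁₃CoPH_gaussPinH)
open BalabanUVNodesN11Sect3SupplyChainDefs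
open BalabanUVNodesN11Sect3SupplyChainObligationsDefs
open BalabanUVNodesN11Sect3SupplyChainNodeAtNumerics (one_le_M_stage12NumericsOfThm1CCMW)
open BalabanUVNodesN11NodeFacesOfSupplyChainTokens
open BalabanUVNodesN11NodeFacesOfSupplyChainTokensAtWitness
open BalabanUVNodesN11NodeFacesOfSupplyChainTokensOperandRoads (supplyChainAt_family_of_gaussCert_of_operandRows)

variable {F : T4Family} {N : ℕ} [NeZero N]

/-! ## §1  At DEF-1's ALL-NUMERICS z-witness family `θ₁₃ᶻ(n, ε₂₉; Efl, logz) = theta13LiveOfNumericsZ F N n ε₂₉ ζ Rz Zt Efl logz` (= `(theta13OfNumericsZ …).liveRepin₁₃`, `rfl`):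
`n.Pos`, `0 < ε₂₉`, signs and `1 ≤ M` of `n` — the letters `Efl`, `logz` are NOT read -/

section NumericsZ

variable {n : Stage12Numerics} {ε₂₉ : ℝ} {ζ : ZetaOfRecord F N n.ν n.τ9.M} {Rz : (K : ℕ) → Sect2.Residual (F.P K) (MatA N)}
  {Zt : (K : ℕ) → TkResidualW F N (FluctV N) K} {Efl logz : B12.RunParams → ℕ → ℝ} {θ : Stage13HParams F N}

/-- **★ N11's DAG NODE AT EVERY RUN AT ANY H-EXTENSION OF `θ₁₃ᶻ(n, ε₂₉; Efl, logz)` FROM A FAMILY OF TOKENS ON THE STEP WINDOW `]0, γ′]`** (world bound to the CoPH datum,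
`w.γ ≤ γ′`; Z2's `admissible_theta13OfNumericsZ` — whatever the letters). [cite: Balaban1988Convergent, Thm 1 p.262, Theorem p.245, p.244 L36–38, §3 p.279, (1.15) p.249, (2.4) p.255, (2.10) p.256; Balaban1989LargeFieldII, (0.15) p.360; Balaban1989LargeFieldI, (0.3)–(0.4) p.176, p.177 (i)–(ii)] -/
theorem b14_main_leavesP_all_theta13LiveOfNumericsZH_of_supplyChainAt_family (hθ : θ.toStage13Params = theta13LiveOfNumericsZ F N n ε₂₉ ζ Rz Zt Efl logz) (hn : n.Pos)
    (hε' : 0 < ε₂₉) (hκ : 0 ≤ n.s2.lf.κ) (hE₀ : 0 ≤ n.s2.lf.E₀) (hB₀ : 0 ≤ n.s2.lf.B₀) (hM : 1 ≤ n.τ9.M) (hrec : θ.Provisos₁₃CoPH F N) {γ' : ℝ}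
    (hN : ∀ P : B12.RunParams, Step.InInterval γ' P.K (gOfRecord₁₃ F N θ.toStage13Params P) → SupplyChainAt θ P)
    (w : WorldP) (hC : w.C = (datumOfRecord₁₃CoPH F N θ hrec).C) (hγw : w.γ ≤ γ') : ∀ P : B12.RunParams, Dag.B14_main (leavesP w P) :=
  b14_main_leavesP_all_liveRepinH_of_supplyChainAt_family (θ₀ := theta13OfNumericsZ F N n ε₂₉ ζ Rz Zt Efl logz) hθ
    (admissible_theta13OfNumericsZ F N ζ Rz Zt Efl logz hn hε') hκ hE₀ hB₀ hM hrec hN w hC hγw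

/-- **★ `B16.Thm1Printed` AT THE CoPH DATUM OF ANY H-EXTENSION OF `θ₁₃ᶻ(n, ε₂₉; Efl, logz)` FROM A FAMILY OF TOKENS ON THE STEP WINDOW `]0, γ′]`, `0 < γ′`.**
[cite: Balaban1988Convergent, Thm 1 p.262, Theorem p.245, p.244 L36–38, §3 p.279, (1.15) p.249; Balaban1989LargeFieldII, Thm 1 p.355, (0.15) p.360; Balaban1989LargeFieldI, (0.3)–(0.4) p.176] -/
theorem thm1Printed_datumOfRecord₁₃CoPH_theta13LiveOfNumericsZH_of_supplyChainAt_family (hθ : θ.toStage13Params = theta13LiveOfNumericsZ F N n ε₂₉ ζ Rz Zt Efl logz)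
    (hn : n.Pos) (hε' : 0 < ε₂₉) (hκ : 0 ≤ n.s2.lf.κ) (hE₀ : 0 ≤ n.s2.lf.E₀) (hB₀ : 0 ≤ n.s2.lf.B₀) (hM : 1 ≤ n.τ9.M) (hrec : θ.Provisos₁₃CoPH F N)
    {γ' : ℝ} (hγ' : 0 < γ') (hN : ∀ P : B12.RunParams, Step.InInterval γ' P.K (gOfRecord₁₃ F N θ.toStage13Params P) → SupplyChainAt θ P) :
    B16.Thm1Printed (datumOfRecord₁₃CoPH F N θ hrec).C :=
  thm1Printed_datumOfRecord₁₃CoPH_liveRepinH_of_supplyChainAt_family (θ₀ := theta13OfNumericsZ F N n ε₂₉ ζ Rz Zt Efl logz) hθ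
    (admissible_theta13OfNumericsZ F N ζ Rz Zt Efl logz hn hε') hκ hE₀ hB₀ hM hrec hγ' hN

/-- **★★ THE `h11`-SHAPED FAMILY AT THE SepCoPH DATUM OF ANY H-EXTENSION OF `θ₁₃ᶻ(n, ε₂₉; Efl, logz)` FROM A FAMILY OF TOKENS ON THE STEP WINDOW `]0, γ′]`, `0 < γ′`** (`γ₁₁ := γ′`;
only `smallCouplings` read). [cite: Balaban1988Convergent, Theorem p.245, Thm 1 p.262, remark p.262, p.244 L36–38, §3 p.279, (1.15) p.249; Balaban1989LargeFieldII, Thm 1 + (0.1) pp.355–356, (0.15) p.360; Balaban1989LargeFieldI, (0.3)–(0.4) p.176] -/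
theorem h11Family_theta13LiveOfNumericsZH_of_supplyChainAt_family (hθ : θ.toStage13Params = theta13LiveOfNumericsZ F N n ε₂₉ ζ Rz Zt Efl logz) (hn : n.Pos)
    (hε' : 0 < ε₂₉) (hκ : 0 ≤ n.s2.lf.κ) (hE₀ : 0 ≤ n.s2.lf.E₀) (hB₀ : 0 ≤ n.s2.lf.B₀) (hM : 1 ≤ n.τ9.M) (hrec : θ.Provisos₁₃SepCoPH F N) {γ' : ℝ} (hγ' : 0 < γ')
    (hN : ∀ P : B12.RunParams, Step.InInterval γ' P.K (gOfRecord₁₃ F N θ.toStage13Params P) → SupplyChainAt θ P) :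
    ∀ βup β₀ : ℝ, ∃ γ₁₁ : ℝ, 0 < γ₁₁ ∧ ∀ w : WorldP, w.C = (datumOfRecord₁₃SepCoPH F N θ hrec).C → w.βup = βup → w.β₀ = β₀ → w.γ ≤ γ₁₁ →
      ∀ P : B12.RunParams, (leavesP w P).b7 → (leavesP w P).b8 → (leavesP w P).b9 → (leavesP w P).b10 → (leavesP w P).b11 →
      (leavesP w P).smallCouplings → (leavesP w P).smallFieldInductive → (leavesP w P).flowControl →
        ∀ k, k < P.K → SLaw₁₃CoPH F N θ P k → TLaw₁₃CoPH F N θ P k :=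
  h11Family_liveRepinH_of_supplyChainAt_family (θ₀ := theta13OfNumericsZ F N n ε₂₉ ζ Rz Zt Efl logz) hθ
    (admissible_theta13OfNumericsZ F N ζ Rz Zt Efl logz hn hε') hκ hE₀ hB₀ hM hrec hγ' hN

end NumericsZ

/-! ## §2  At the windowed collared z-witness `θ₁₅ᶜᶜᴹᵂᶻ(j; γ; Efl, logz) = theta13OfThm1CCMWZ F N j γ ε₀ ε₂₉ B₃ B₃' a₀ a₁ Efl logz`: the window `0 < γ ≤ ½` and the six signs ONLY -/

section K1WitnessZ

variable {j : ℕ} {γ ε₀ ε₂₉ B₃ B₃' a₀ a₁ : ℝ} {Efl logz : B12.RunParams → ℕ → ℝ} {θ : Stage13HParams F N}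

/-- **★ N11's DAG NODE AT EVERY RUN AT ANY H-EXTENSION OF THE z-WITNESS `θ₁₅ᶜᶜᴹᵂᶻ(j; γ; Efl, logz)` FROM A FAMILY OF TOKENS ON THE STEP WINDOW `]0, γ′]`** — world bound to the
CoPH datum (`hrec` the key), `w.γ ≤ γ′`; window `0 < γ ≤ ½` + six signs (`stage12NumericsOfThm1CCMW_pos_of_le_half`; numerals `κ = 2·10⁴`, `E₀ = B₀ = 1`, `M = L^j ≥ 1`); the
letters `Efl`, `logz` are NOT read. [cite: Balaban1988Convergent, Thm 1 p.262, Theorem p.245, p.244 L36–38, §3 p.279, (1.15) p.249, (2.4) p.255, (2.10) p.256; Balaban1987RG1, Thm 1 p.259; Balaban1989LargeFieldII, (0.15) p.360; Balaban1989LargeFieldI, (0.3)–(0.4) p.176, p.177 (i)–(ii)] -/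
theorem b14_main_leavesP_all_theta13OfThm1CCMWZH_of_supplyChainAt_family (hθ : θ.toStage13Params = theta13OfThm1CCMWZ F N j γ ε₀ ε₂₉ B₃ B₃' a₀ a₁ Efl logz)
    (hγ₀ : 0 < γ) (hγh : γ ≤ 1 / 2) (hε : 0 < ε₀) (hε' : 0 < ε₂₉) (hB : 0 ≤ B₃) (hB' : 0 ≤ B₃') (ha₀ : 0 < a₀) (ha₁ : 0 < a₁) (hrec : θ.Provisos₁₃CoPH F N)
    {γ' : ℝ} (hN : ∀ P : B12.RunParams, Step.InInterval γ' P.K (gOfRecord₁₃ F N θ.toStage13Params P) → SupplyChainAt θ P)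
    (w : WorldP) (hC : w.C = (datumOfRecord₁₃CoPH F N θ hrec).C) (hγw : w.γ ≤ γ') : ∀ P : B12.RunParams, Dag.B14_main (leavesP w P) :=
  b14_main_leavesP_all_theta13LiveOfNumericsZH_of_supplyChainAt_family hθ (stage12NumericsOfThm1CCMW_pos_of_le_half F.hL.2.le hγ₀ hγh hε hB hB' ha₀ ha₁) hε'
    (by rw [show (stage12NumericsOfThm1CCMW F.L j γ ε₀ B₃ B₃' a₀ a₁).s2.lf.κ = 20000 from rfl]; norm_num)
    (by rw [show (stage12NumericsOfThm1CCMW F.L j γ ε₀ B₃ B₃' a₀ a₁).s2.lf.E₀ = 1 from rfl]; norm_num)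
    (by rw [show (stage12NumericsOfThm1CCMW F.L j γ ε₀ B₃ B₃' a₀ a₁).s2.lf.B₀ = 1 from rfl]; norm_num)
    (one_le_M_stage12NumericsOfThm1CCMW F j γ ε₀ B₃ B₃' a₀ a₁) hrec hN w hC hγw

/-- **★ `B16.Thm1Printed` AT THE CoPH DATUM OF ANY H-EXTENSION OF `θ₁₅ᶜᶜᴹᵂᶻ(j; γ; Efl, logz)` FROM A FAMILY OF TOKENS ON THE STEP WINDOW `]0, γ′]`, `0 < γ′`** (window `0 < γ ≤ ½`
+ six signs). [cite: Balaban1988Convergent, Thm 1 p.262, Theorem p.245, p.244 L36–38, §3 p.279, (1.15) p.249; Balaban1989LargeFieldII, Thm 1 p.355, (0.15) p.360; Balaban1987RG1, Thm 1 p.259; Balaban1989LargeFieldI, (0.3)–(0.4) p.176] -/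
theorem thm1Printed_datumOfRecord₁₃CoPH_theta13OfThm1CCMWZH_of_supplyChainAt_family (hθ : θ.toStage13Params = theta13OfThm1CCMWZ F N j γ ε₀ ε₂₉ B₃ B₃' a₀ a₁ Efl logz)
    (hγ₀ : 0 < γ) (hγh : γ ≤ 1 / 2) (hε : 0 < ε₀) (hε' : 0 < ε₂₉) (hB : 0 ≤ B₃) (hB' : 0 ≤ B₃') (ha₀ : 0 < a₀) (ha₁ : 0 < a₁) (hrec : θ.Provisos₁₃CoPH F N)
    {γ' : ℝ} (hγ' : 0 < γ') (hN : ∀ P : B12.RunParams, Step.InInterval γ' P.K (gOfRecord₁₃ F N θ.toStage13Params P) → SupplyChainAt θ P) :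
    B16.Thm1Printed (datumOfRecord₁₃CoPH F N θ hrec).C :=
  thm1Printed_datumOfRecord₁₃CoPH_theta13LiveOfNumericsZH_of_supplyChainAt_family hθ (stage12NumericsOfThm1CCMW_pos_of_le_half F.hL.2.le hγ₀ hγh hε hB hB' ha₀ ha₁) hε'
    (by rw [show (stage12NumericsOfThm1CCMW F.L j γ ε₀ B₃ B₃' a₀ a₁).s2.lf.κ = 20000 from rfl]; norm_num)
    (by rw [show (stage12NumericsOfThm1CCMW F.L j γ ε₀ B₃ B₃' a₀ a₁).s2.lf.E₀ = 1 from rfl]; norm_num)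
    (by rw [show (stage12NumericsOfThm1CCMW F.L j γ ε₀ B₃ B₃' a₀ a₁).s2.lf.B₀ = 1 from rfl]; norm_num)
    (one_le_M_stage12NumericsOfThm1CCMW F j γ ε₀ B₃ B₃' a₀ a₁) hrec hγ' hN

/-- **★★ THE `h11`-SHAPED FAMILY AT THE SepCoPH DATUM OF ANY H-EXTENSION OF `θ₁₅ᶜᶜᴹᵂᶻ(j; γ; Efl, logz)` FROM A FAMILY OF TOKENS ON THE STEP WINDOW `]0, γ′]`, `0 < γ′`**
(`γ₁₁ := γ′`; window `0 < γ ≤ ½` + six signs; only `smallCouplings` read) — dag-n24-c's N11 child SHAPE at the z-witness. [cite: Balaban1988Convergent, Theorem p.245, Thm 1 p.262, remark p.262, p.244 L36–38, §3 p.279, (1.15) p.249; Balaban1989LargeFieldII, Thm 1 + (0.1) pp.355–356, (0.15) p.360; Balaban1987RG1, Thm 1 p.259; Balaban1989LargeFieldI, (0.3)–(0.4) p.176] -/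
theorem h11Family_theta13OfThm1CCMWZH_of_supplyChainAt_family (hθ : θ.toStage13Params = theta13OfThm1CCMWZ F N j γ ε₀ ε₂₉ B₃ B₃' a₀ a₁ Efl logz)
    (hγ₀ : 0 < γ) (hγh : γ ≤ 1 / 2) (hε : 0 < ε₀) (hε' : 0 < ε₂₉) (hB : 0 ≤ B₃) (hB' : 0 ≤ B₃') (ha₀ : 0 < a₀) (ha₁ : 0 < a₁) (hrec : θ.Provisos₁₃SepCoPH F N)
    {γ' : ℝ} (hγ' : 0 < γ') (hN : ∀ P : B12.RunParams, Step.InInterval γ' P.K (gOfRecord₁₃ F N θ.toStage13Params P) → SupplyChainAt θ P) :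
    ∀ βup β₀ : ℝ, ∃ γ₁₁ : ℝ, 0 < γ₁₁ ∧ ∀ w : WorldP, w.C = (datumOfRecord₁₃SepCoPH F N θ hrec).C → w.βup = βup → w.β₀ = β₀ → w.γ ≤ γ₁₁ →
      ∀ P : B12.RunParams, (leavesP w P).b7 → (leavesP w P).b8 → (leavesP w P).b9 → (leavesP w P).b10 → (leavesP w P).b11 →
      (leavesP w P).smallCouplings → (leavesP w P).smallFieldInductive → (leavesP w P).flowControl →
        ∀ k, k < P.K → SLaw₁₃CoPH F N θ P k → TLaw₁₃CoPH F N θ P k :=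
  h11Family_theta13LiveOfNumericsZH_of_supplyChainAt_family hθ (stage12NumericsOfThm1CCMW_pos_of_le_half F.hL.2.le hγ₀ hγh hε hB hB' ha₀ ha₁) hε'
    (by rw [show (stage12NumericsOfThm1CCMW F.L j γ ε₀ B₃ B₃' a₀ a₁).s2.lf.κ = 20000 from rfl]; norm_num)
    (by rw [show (stage12NumericsOfThm1CCMW F.L j γ ε₀ B₃ B₃' a₀ a₁).s2.lf.E₀ = 1 from rfl]; norm_num)
    (by rw [show (stage12NumericsOfThm1CCMW F.L j γ ε₀ B₃ B₃' a₀ a₁).s2.lf.B₀ = 1 from rfl]; norm_num)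
    (one_le_M_stage12NumericsOfThm1CCMW F j γ ε₀ B₃ B₃' a₀ a₁) hrec hγ' hN

end K1WitnessZ

/-! ## §3  At the certificate `θᴳᶻ := gaussPinH (Stage13HParams.ofHistoryBlind F N ⟨θ₁₅ᶜᶜᴹᵂᶻ, Zr⟩)` of the z-witness: the `h11` child from the windowed token family; the
CONTINUITY-road and OPERAND-ROWS-road editions; N11's node on the continuity road (`θᴳᶻ.toStage13Params = θ₁₅ᶜᶜᴹᵂᶻ`, `rfl`) -/

section CertificateZ

variable {j : ℕ} {γ ε₀ ε₂₉ B₃ B₃' a₀ a₁ : ℝ} {Efl logz : B12.RunParams → ℕ → ℝ} (Zr : (q : B12.RunParams) → TkResidualW F N (FluctV N) q.K)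

/-- **★★★ N11's CHILD FAMILY IN dag-n24-c's `h11` SHAPE AT `θᴳᶻ`'s SepCoPH DATUM FROM A FAMILY OF TOKENS ON THE STEP WINDOW `]0, γ′]`, `0 < γ′`** (any door proof `hG` keys the
datum; `γ₁₁ := γ′`; window `0 < γ ≤ ½` + six signs; letters NOT read): the token asked on windowed runs only — what the supplier roads deliver. [cite: Balaban1988Convergent, Theorem p.245, Thm 1 p.262, remark p.262, p.244 L36–38, §3 p.279, (3.16) p.268, (1.15) p.249; Balaban1989LargeFieldII, Thm 1 + (0.1) pp.355–356, (0.15) p.360; Balaban1987RG1, Thm 1 p.259; Balaban1989LargeFieldI, (0.3)–(0.4) p.176] -/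
theorem h11Family_gaussPinH_ofHistoryBlind_theta13OfThm1CCMWZ_of_supplyChainAt_family (hγ₀ : 0 < γ) (hγh : γ ≤ 1 / 2) (hε : 0 < ε₀) (hε' : 0 < ε₂₉)
    (hB : 0 ≤ B₃) (hB' : 0 ≤ B₃') (ha₀ : 0 < a₀) (ha₁ : 0 < a₁)
    (hG : (gaussPinH (Stage13HParams.ofHistoryBlind F N ⟨theta13OfThm1CCMWZ F N j γ ε₀ ε₂₉ B₃ B₃' a₀ a₁ Efl logz, Zr⟩)).Provisos₁₃SepCoPH F N) {γ' : ℝ} (hγ' : 0 < γ')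
    (hN : ∀ P : B12.RunParams, Step.InInterval γ' P.K (gOfRecord₁₃ F N (theta13OfThm1CCMWZ F N j γ ε₀ ε₂₉ B₃ B₃' a₀ a₁ Efl logz) P) →
      SupplyChainAt (gaussPinH (Stage13HParams.ofHistoryBlind F N ⟨theta13OfThm1CCMWZ F N j γ ε₀ ε₂₉ B₃ B₃' a₀ a₁ Efl logz, Zr⟩)) P) :
    ∀ βup β₀ : ℝ, ∃ γ₁₁ : ℝ, 0 < γ₁₁ ∧ ∀ w : WorldP,
      w.C = (datumOfRecord₁₃SepCoPH F N (gaussPinH (Stage13HParams.ofHistoryBlind F N ⟨theta13OfThm1CCMWZ F N j γ ε₀ ε₂₉ B₃ B₃' a₀ a₁ Efl logz, Zr⟩)) hG).C →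
      w.βup = βup → w.β₀ = β₀ → w.γ ≤ γ₁₁ → ∀ P : B12.RunParams, (leavesP w P).b7 → (leavesP w P).b8 → (leavesP w P).b9 → (leavesP w P).b10 → (leavesP w P).b11 →
      (leavesP w P).smallCouplings → (leavesP w P).smallFieldInductive → (leavesP w P).flowControl →
        ∀ k, k < P.K → SLaw₁₃CoPH F N (gaussPinH (Stage13HParams.ofHistoryBlind F N ⟨theta13OfThm1CCMWZ F N j γ ε₀ ε₂₉ B₃ B₃' a₀ a₁ Efl logz, Zr⟩)) P k →
          TLaw₁₃CoPH F N (gaussPinH (Stage13HParams.ofHistoryBlind F N ⟨theta13OfThm1CCMWZ F N j γ ε₀ ε₂₉ B₃ B₃' a₀ a₁ Efl logz, Zr⟩)) P k :=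
  h11Family_theta13OfThm1CCMWZH_of_supplyChainAt_family (θ := gaussPinH (Stage13HParams.ofHistoryBlind F N ⟨theta13OfThm1CCMWZ F N j γ ε₀ ε₂₉ B₃ B₃' a₀ a₁ Efl logz, Zr⟩))
    rfl hγ₀ hγh hε hε' hB hB' ha₀ ha₁ hG hγ' hN

/-- **★★★ N11's CHILD FAMILY IN dag-n24-c's `h11` SHAPE AT `θᴳᶻ`'s SepCoPH DATUM ON THE CONTINUITY ROAD** — from, PER WINDOWED RUN (`Step.InInterval γ′ P.K (gOfRecord₁₃ θ₁₅ᶜᶜᴹᵂᶻ P)`,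
`0 < γ′`), [III] §3's supplier `σ P` at `θᴳᶻ` with `SupplierObligations` whose chain terms are CONTINUOUS in the configuration (resp. (configuration, fluctuation)) with the two displayed
real-part BOUNDS (this seat's G rows), the door key `hG` — NOTHING ELSE: no `cR`, no K0 row, no bg fact, no run guard, no operand row; window `0 < γ ≤ ½` + six signs; letters NOT
read; `γ₁₁ := γ′`.  THE HONEST STATE of N11's K1-road child at the z-witness certificate on the continuity road: the ONE displayed analytic binder is [III] §3's supplier with its
obligations and continuous bounded terms (Thm 2 proper — XL, nobody's theorem). [cite: Balaban1988Convergent, Theorem p.245, Thm 1 p.262, remark p.262, p.244 L36–38, §3 p.279, (3.16)–(3.21) pp.268–269, (3.23)–(3.25) p.270, (1.15) p.249; Balaban1989LargeFieldII, Thm 1 + (0.1) pp.355–356, (0.15) p.360; Balaban1987RG1, Thm 1 p.259; Balaban1989LargeFieldI, (0.3)–(0.4) p.176, p.177 (i)–(ii)] -/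
theorem h11Family_gaussPinH_ofHistoryBlind_theta13OfThm1CCMWZ_of_continuous (hγ₀ : 0 < γ) (hγh : γ ≤ 1 / 2) (hε : 0 < ε₀) (hε' : 0 < ε₂₉)
    (hB : 0 ≤ B₃) (hB' : 0 ≤ B₃') (ha₀ : 0 < a₀) (ha₁ : 0 < a₁)
    (hG : (gaussPinH (Stage13HParams.ofHistoryBlind F N ⟨theta13OfThm1CCMWZ F N j γ ε₀ ε₂₉ B₃ B₃' a₀ a₁ Efl logz, Zr⟩)).Provisos₁₃SepCoPH F N) {γ' : ℝ} (hγ' : 0 < γ')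
    (σ : (P : B12.RunParams) → Sect3Supplier (gaussPinH (Stage13HParams.ofHistoryBlind F N ⟨theta13OfThm1CCMWZ F N j γ ε₀ ε₂₉ B₃ B₃' a₀ a₁ Efl logz, Zr⟩)) P)
    (hσ : ∀ P : B12.RunParams, Step.InInterval γ' P.K (gOfRecord₁₃ F N (theta13OfThm1CCMWZ F N j γ ε₀ ε₂₉ B₃ B₃' a₀ a₁ Efl logz) P) →
      SupplierObligations (gaussPinH (Stage13HParams.ofHistoryBlind F N ⟨theta13OfThm1CCMWZ F N j γ ε₀ ε₂₉ B₃ B₃' a₀ a₁ Efl logz, Zr⟩)) P (σ P))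
    (hE : ∀ P : B12.RunParams, Step.InInterval γ' P.K (gOfRecord₁₃ F N (theta13OfThm1CCMWZ F N j γ ε₀ ε₂₉ B₃ B₃' a₀ a₁ Efl logz) P) →
      ∀ (k : ℕ) (s : SeqOfRecord F (theta13OfThm1CCMWZ F N j γ ε₀ ε₂₉ B₃ B₃' a₀ a₁ Efl logz).ν (theta13OfThm1CCMWZ F N j γ ε₀ ε₂₉ B₃ B₃' a₀ a₁ Efl logz).τ9.M
        (gOfRecord₁₃ F N (theta13OfThm1CCMWZ F N j γ ε₀ ε₂₉ B₃ B₃' a₀ a₁ Efl logz) P) P.K (k + 1)) (i : ℕ), 1 ≤ i →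
      ∀ (X : (Sect2.domSys (F.P P.K) (theta13OfThm1CCMWZ F N j γ ε₀ ε₂₉ B₃ B₃' a₀ a₁ Efl logz).τ9.M i).Dom) (z : Site (F.P P.K) i) (g' : ℝ),
      Continuous (fun U : GaugeField (F.P P.K) 0 (SU N) =>
        ((σ P k (chainWitness _ P (σ P) k).1 (chainWitness _ P (σ P) k).2).1 s).E i X z g'
          (Sect2.ofBackgroundC (settingOfRecord₁₃ F N (theta13OfThm1CCMWZ F N j γ ε₀ ε₂₉ B₃ B₃' a₀ a₁ Efl logz) P).ι U)))
    (hCE : ∀ P : B12.RunParams, Step.InInterval γ' P.K (gOfRecord₁₃ F N (theta13OfThm1CCMWZ F N j γ ε₀ ε₂₉ B₃ B₃' a₀ a₁ Efl logz) P) →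
      ∀ (k : ℕ) (s : SeqOfRecord F (theta13OfThm1CCMWZ F N j γ ε₀ ε₂₉ B₃ B₃' a₀ a₁ Efl logz).ν (theta13OfThm1CCMWZ F N j γ ε₀ ε₂₉ B₃ B₃' a₀ a₁ Efl logz).τ9.M
        (gOfRecord₁₃ F N (theta13OfThm1CCMWZ F N j γ ε₀ ε₂₉ B₃ B₃' a₀ a₁ Efl logz) P) P.K (k + 1)) (i : ℕ), 1 ≤ i → ∃ CE : ℝ,
      ∀ (X : (Sect2.domSys (F.P P.K) (theta13OfThm1CCMWZ F N j γ ε₀ ε₂₉ B₃ B₃' a₀ a₁ Efl logz).τ9.M i).Dom) (z : Site (F.P P.K) i) (g' : ℝ) (U : GaugeField (F.P P.K) 0 (SU N)),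
      |(((σ P k (chainWitness _ P (σ P) k).1 (chainWitness _ P (σ P) k).2).1 s).E i X z g'
          (Sect2.ofBackgroundC (settingOfRecord₁₃ F N (theta13OfThm1CCMWZ F N j γ ε₀ ε₂₉ B₃ B₃' a₀ a₁ Efl logz) P).ι U)).re| ≤ CE)
    (hR : ∀ P : B12.RunParams, Step.InInterval γ' P.K (gOfRecord₁₃ F N (theta13OfThm1CCMWZ F N j γ ε₀ ε₂₉ B₃ B₃' a₀ a₁ Efl logz) P) →
      ∀ (k : ℕ) (s : SeqOfRecord F (theta13OfThm1CCMWZ F N j γ ε₀ ε₂₉ B₃ B₃' a₀ a₁ Efl logz).ν (theta13OfThm1CCMWZ F N j γ ε₀ ε₂₉ B₃ B₃' a₀ a₁ Efl logz).τ9.M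
        (gOfRecord₁₃ F N (theta13OfThm1CCMWZ F N j γ ε₀ ε₂₉ B₃ B₃' a₀ a₁ Efl logz) P) P.K (k + 1)) (i : ℕ), 1 ≤ i →
      ∀ X : (Sect2.domSys (F.P P.K) (theta13OfThm1CCMWZ F N j γ ε₀ ε₂₉ B₃ B₃' a₀ a₁ Efl logz).τ9.M i).Dom,
      Continuous (fun U : GaugeField (F.P P.K) 0 (SU N) =>
        ((σ P k (chainWitness _ P (σ P) k).1 (chainWitness _ P (σ P) k).2).1 s).R i X
          (Sect2.ofBackgroundC (settingOfRecord₁₃ F N (theta13OfThm1CCMWZ F N j γ ε₀ ε₂₉ B₃ B₃' a₀ a₁ Efl logz) P).ι U)))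
    (hB9 : ∀ P : B12.RunParams, Step.InInterval γ' P.K (gOfRecord₁₃ F N (theta13OfThm1CCMWZ F N j γ ε₀ ε₂₉ B₃ B₃' a₀ a₁ Efl logz) P) →
      ∀ (k : ℕ) (s : SeqOfRecord F (theta13OfThm1CCMWZ F N j γ ε₀ ε₂₉ B₃ B₃' a₀ a₁ Efl logz).ν (theta13OfThm1CCMWZ F N j γ ε₀ ε₂₉ B₃ B₃' a₀ a₁ Efl logz).τ9.M
        (gOfRecord₁₃ F N (theta13OfThm1CCMWZ F N j γ ε₀ ε₂₉ B₃ B₃' a₀ a₁ Efl logz) P) P.K (k + 1)) (S' : ℕ → Set (Site (F.P P.K) 0)) (i : ℕ)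
        (X : (Sect2.domSys (F.P P.K) (theta13OfThm1CCMWZ F N j γ ε₀ ε₂₉ B₃ B₃' a₀ a₁ Efl logz).τ9.M i).Dom),
      Continuous (fun q : GaugeField (F.P P.K) 0 (SU N) × MSFluct (F.P P.K) (FluctV N) =>
        ((σ P k (chainWitness _ P (σ P) k).1 (chainWitness _ P (σ P) k).2).1 s).B i X
          (Sect2.ofBackgroundC (settingOfRecord₁₃ F N (theta13OfThm1CCMWZ F N j γ ε₀ ε₂₉ B₃ B₃' a₀ a₁ Efl logz) P).ι q.1) (S', q.2)))
    (hCB : ∀ P : B12.RunParams, Step.InInterval γ' P.K (gOfRecord₁₃ F N (theta13OfThm1CCMWZ F N j γ ε₀ ε₂₉ B₃ B₃' a₀ a₁ Efl logz) P) →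
      ∀ (k : ℕ) (s : SeqOfRecord F (theta13OfThm1CCMWZ F N j γ ε₀ ε₂₉ B₃ B₃' a₀ a₁ Efl logz).ν (theta13OfThm1CCMWZ F N j γ ε₀ ε₂₉ B₃ B₃' a₀ a₁ Efl logz).τ9.M
        (gOfRecord₁₃ F N (theta13OfThm1CCMWZ F N j γ ε₀ ε₂₉ B₃ B₃' a₀ a₁ Efl logz) P) P.K (k + 1)) (i : ℕ), 1 ≤ i → ∃ CB : ℝ,
      ∀ (X : (Sect2.domSys (F.P P.K) (theta13OfThm1CCMWZ F N j γ ε₀ ε₂₉ B₃ B₃' a₀ a₁ Efl logz).τ9.M i).Dom) (U : GaugeField (F.P P.K) 0 (SU N)) (a : Tk.SFluct (F.P P.K) (FluctV N)),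
      |(((σ P k (chainWitness _ P (σ P) k).1 (chainWitness _ P (σ P) k).2).1 s).B i X
          (Sect2.ofBackgroundC (settingOfRecord₁₃ F N (theta13OfThm1CCMWZ F N j γ ε₀ ε₂₉ B₃ B₃' a₀ a₁ Efl logz) P).ι U) a).re| ≤ CB) :
    ∀ βup β₀ : ℝ, ∃ γ₁₁ : ℝ, 0 < γ₁₁ ∧ ∀ w : WorldP,
      w.C = (datumOfRecord₁₃SepCoPH F N (gaussPinH (Stage13HParams.ofHistoryBlind F N ⟨theta13OfThm1CCMWZ F N j γ ε₀ ε₂₉ B₃ B₃' a₀ a₁ Efl logz, Zr⟩)) hG).C →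
      w.βup = βup → w.β₀ = β₀ → w.γ ≤ γ₁₁ → ∀ P : B12.RunParams, (leavesP w P).b7 → (leavesP w P).b8 → (leavesP w P).b9 → (leavesP w P).b10 → (leavesP w P).b11 →
      (leavesP w P).smallCouplings → (leavesP w P).smallFieldInductive → (leavesP w P).flowControl →
        ∀ k, k < P.K → SLaw₁₃CoPH F N (gaussPinH (Stage13HParams.ofHistoryBlind F N ⟨theta13OfThm1CCMWZ F N j γ ε₀ ε₂₉ B₃ B₃' a₀ a₁ Efl logz, Zr⟩)) P k →
          TLaw₁₃CoPH F N (gaussPinH (Stage13HParams.ofHistoryBlind F N ⟨theta13OfThm1CCMWZ F N j γ ε₀ ε₂₉ B₃ B₃' a₀ a₁ Efl logz, Zr⟩)) P k :=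
  h11Family_gaussPinH_ofHistoryBlind_theta13OfThm1CCMWZ_of_supplyChainAt_family Zr hγ₀ hγh hε hε' hB hB' ha₀ ha₁ hG hγ'
    (supplyChainAt_family_of_gaussCert_of_continuous (gaussPinH (Stage13HParams.ofHistoryBlind F N ⟨theta13OfThm1CCMWZ F N j γ ε₀ ε₂₉ B₃ B₃' a₀ a₁ Efl logz, Zr⟩))
      (gaussPinH_ζ0 _) (gaussPinH_quad _) hG.toCore (one_le_M_stage12NumericsOfThm1CCMW F j γ ε₀ B₃ B₃' a₀ a₁) σ hσ hE hCE hR hB9 hCB)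

/-- **★★ N11's DAG NODE AT EVERY RUN AT A WORLD BOUND TO `θᴳᶻ`'s CoPH DATUM ON THE CONTINUITY ROAD** (`w.γ ≤ γ′`; door core `hrec` keys the datum; window `0 < γ ≤ ½` + six signs;
letters NOT read): from, per windowed run, [III] §3's supplier at `θᴳᶻ` with `SupplierObligations` and continuous bounded terms — NOTHING ELSE displayed.  `βup ∕ β₀ ∕ b ∕ gR ∕ up`
UNREAD. [cite: Balaban1988Convergent, Thm 1 p.262, Theorem p.245, p.244 L36–38, §3 p.279, (3.16)–(3.21) pp.268–269, (3.23)–(3.25) p.270, (1.15) p.249; Balaban1989LargeFieldII, Introduction pp.355–356, (0.15) p.360; Balaban1987RG1, Thm 1 p.259; Balaban1989LargeFieldI, (0.3)–(0.4) p.176, p.177 (i)–(ii)] -/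
theorem b14_main_leavesP_all_gaussPinH_ofHistoryBlind_theta13OfThm1CCMWZ_of_continuous (hγ₀ : 0 < γ) (hγh : γ ≤ 1 / 2) (hε : 0 < ε₀) (hε' : 0 < ε₂₉)
    (hB : 0 ≤ B₃) (hB' : 0 ≤ B₃') (ha₀ : 0 < a₀) (ha₁ : 0 < a₁)
    (hrec : (gaussPinH (Stage13HParams.ofHistoryBlind F N ⟨theta13OfThm1CCMWZ F N j γ ε₀ ε₂₉ B₃ B₃' a₀ a₁ Efl logz, Zr⟩)).Provisos₁₃CoPH F N) {γ' : ℝ}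
    (σ : (P : B12.RunParams) → Sect3Supplier (gaussPinH (Stage13HParams.ofHistoryBlind F N ⟨theta13OfThm1CCMWZ F N j γ ε₀ ε₂₉ B₃ B₃' a₀ a₁ Efl logz, Zr⟩)) P)
    (hσ : ∀ P : B12.RunParams, Step.InInterval γ' P.K (gOfRecord₁₃ F N (theta13OfThm1CCMWZ F N j γ ε₀ ε₂₉ B₃ B₃' a₀ a₁ Efl logz) P) →
      SupplierObligations (gaussPinH (Stage13HParams.ofHistoryBlind F N ⟨theta13OfThm1CCMWZ F N j γ ε₀ ε₂₉ B₃ B₃' a₀ a₁ Efl logz, Zr⟩)) P (σ P))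
    (hE : ∀ P : B12.RunParams, Step.InInterval γ' P.K (gOfRecord₁₃ F N (theta13OfThm1CCMWZ F N j γ ε₀ ε₂₉ B₃ B₃' a₀ a₁ Efl logz) P) →
      ∀ (k : ℕ) (s : SeqOfRecord F (theta13OfThm1CCMWZ F N j γ ε₀ ε₂₉ B₃ B₃' a₀ a₁ Efl logz).ν (theta13OfThm1CCMWZ F N j γ ε₀ ε₂₉ B₃ B₃' a₀ a₁ Efl logz).τ9.M
        (gOfRecord₁₃ F N (theta13OfThm1CCMWZ F N j γ ε₀ ε₂₉ B₃ B₃' a₀ a₁ Efl logz) P) P.K (k + 1)) (i : ℕ), 1 ≤ i →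
      ∀ (X : (Sect2.domSys (F.P P.K) (theta13OfThm1CCMWZ F N j γ ε₀ ε₂₉ B₃ B₃' a₀ a₁ Efl logz).τ9.M i).Dom) (z : Site (F.P P.K) i) (g' : ℝ),
      Continuous (fun U : GaugeField (F.P P.K) 0 (SU N) =>
        ((σ P k (chainWitness _ P (σ P) k).1 (chainWitness _ P (σ P) k).2).1 s).E i X z g'
          (Sect2.ofBackgroundC (settingOfRecord₁₃ F N (theta13OfThm1CCMWZ F N j γ ε₀ ε₂₉ B₃ B₃' a₀ a₁ Efl logz) P).ι U)))
    (hCE : ∀ P : B12.RunParams, Step.InInterval γ' P.K (gOfRecord₁₃ F N (theta13OfThm1CCMWZ F N j γ ε₀ ε₂₉ B₃ B₃' a₀ a₁ Efl logz) P) →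
      ∀ (k : ℕ) (s : SeqOfRecord F (theta13OfThm1CCMWZ F N j γ ε₀ ε₂₉ B₃ B₃' a₀ a₁ Efl logz).ν (theta13OfThm1CCMWZ F N j γ ε₀ ε₂₉ B₃ B₃' a₀ a₁ Efl logz).τ9.M
        (gOfRecord₁₃ F N (theta13OfThm1CCMWZ F N j γ ε₀ ε₂₉ B₃ B₃' a₀ a₁ Efl logz) P) P.K (k + 1)) (i : ℕ), 1 ≤ i → ∃ CE : ℝ,
      ∀ (X : (Sect2.domSys (F.P P.K) (theta13OfThm1CCMWZ F N j γ ε₀ ε₂₉ B₃ B₃' a₀ a₁ Efl logz).τ9.M i).Dom) (z : Site (F.P P.K) i) (g' : ℝ) (U : GaugeField (F.P P.K) 0 (SU N)),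
      |(((σ P k (chainWitness _ P (σ P) k).1 (chainWitness _ P (σ P) k).2).1 s).E i X z g'
          (Sect2.ofBackgroundC (settingOfRecord₁₃ F N (theta13OfThm1CCMWZ F N j γ ε₀ ε₂₉ B₃ B₃' a₀ a₁ Efl logz) P).ι U)).re| ≤ CE)
    (hR : ∀ P : B12.RunParams, Step.InInterval γ' P.K (gOfRecord₁₃ F N (theta13OfThm1CCMWZ F N j γ ε₀ ε₂₉ B₃ B₃' a₀ a₁ Efl logz) P) →
      ∀ (k : ℕ) (s : SeqOfRecord F (theta13OfThm1CCMWZ F N j γ ε₀ ε₂₉ B₃ B₃' a₀ a₁ Efl logz).ν (theta13OfThm1CCMWZ F N j γ ε₀ ε₂₉ B₃ B₃' a₀ a₁ Efl logz).τ9.M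
        (gOfRecord₁₃ F N (theta13OfThm1CCMWZ F N j γ ε₀ ε₂₉ B₃ B₃' a₀ a₁ Efl logz) P) P.K (k + 1)) (i : ℕ), 1 ≤ i →
      ∀ X : (Sect2.domSys (F.P P.K) (theta13OfThm1CCMWZ F N j γ ε₀ ε₂₉ B₃ B₃' a₀ a₁ Efl logz).τ9.M i).Dom,
      Continuous (fun U : GaugeField (F.P P.K) 0 (SU N) =>
        ((σ P k (chainWitness _ P (σ P) k).1 (chainWitness _ P (σ P) k).2).1 s).R i X
          (Sect2.ofBackgroundC (settingOfRecord₁₃ F N (theta13OfThm1CCMWZ F N j γ ε₀ ε₂₉ B₃ B₃' a₀ a₁ Efl logz) P).ι U)))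
    (hB9 : ∀ P : B12.RunParams, Step.InInterval γ' P.K (gOfRecord₁₃ F N (theta13OfThm1CCMWZ F N j γ ε₀ ε₂₉ B₃ B₃' a₀ a₁ Efl logz) P) →
      ∀ (k : ℕ) (s : SeqOfRecord F (theta13OfThm1CCMWZ F N j γ ε₀ ε₂₉ B₃ B₃' a₀ a₁ Efl logz).ν (theta13OfThm1CCMWZ F N j γ ε₀ ε₂₉ B₃ B₃' a₀ a₁ Efl logz).τ9.M
        (gOfRecord₁₃ F N (theta13OfThm1CCMWZ F N j γ ε₀ ε₂₉ B₃ B₃' a₀ a₁ Efl logz) P) P.K (k + 1)) (S' : ℕ → Set (Site (F.P P.K) 0)) (i : ℕ)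
        (X : (Sect2.domSys (F.P P.K) (theta13OfThm1CCMWZ F N j γ ε₀ ε₂₉ B₃ B₃' a₀ a₁ Efl logz).τ9.M i).Dom),
      Continuous (fun q : GaugeField (F.P P.K) 0 (SU N) × MSFluct (F.P P.K) (FluctV N) =>
        ((σ P k (chainWitness _ P (σ P) k).1 (chainWitness _ P (σ P) k).2).1 s).B i X
          (Sect2.ofBackgroundC (settingOfRecord₁₃ F N (theta13OfThm1CCMWZ F N j γ ε₀ ε₂₉ B₃ B₃' a₀ a₁ Efl logz) P).ι q.1) (S', q.2)))
    (hCB : ∀ P : B12.RunParams, Step.InInterval γ' P.K (gOfRecord₁₃ F N (theta13OfThm1CCMWZ F N j γ ε₀ ε₂₉ B₃ B₃' a₀ a₁ Efl logz) P) →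
      ∀ (k : ℕ) (s : SeqOfRecord F (theta13OfThm1CCMWZ F N j γ ε₀ ε₂₉ B₃ B₃' a₀ a₁ Efl logz).ν (theta13OfThm1CCMWZ F N j γ ε₀ ε₂₉ B₃ B₃' a₀ a₁ Efl logz).τ9.M
        (gOfRecord₁₃ F N (theta13OfThm1CCMWZ F N j γ ε₀ ε₂₉ B₃ B₃' a₀ a₁ Efl logz) P) P.K (k + 1)) (i : ℕ), 1 ≤ i → ∃ CB : ℝ,
      ∀ (X : (Sect2.domSys (F.P P.K) (theta13OfThm1CCMWZ F N j γ ε₀ ε₂₉ B₃ B₃' a₀ a₁ Efl logz).τ9.M i).Dom) (U : GaugeField (F.P P.K) 0 (SU N)) (a : Tk.SFluct (F.P P.K) (FluctV N)),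
      |(((σ P k (chainWitness _ P (σ P) k).1 (chainWitness _ P (σ P) k).2).1 s).B i X
          (Sect2.ofBackgroundC (settingOfRecord₁₃ F N (theta13OfThm1CCMWZ F N j γ ε₀ ε₂₉ B₃ B₃' a₀ a₁ Efl logz) P).ι U) a).re| ≤ CB)
    (w : WorldP) (hC : w.C = (datumOfRecord₁₃CoPH F N (gaussPinH (Stage13HParams.ofHistoryBlind F N ⟨theta13OfThm1CCMWZ F N j γ ε₀ ε₂₉ B₃ B₃' a₀ a₁ Efl logz, Zr⟩)) hrec).C)
    (hγw : w.γ ≤ γ') : ∀ P : B12.RunParams, Dag.B14_main (leavesP w P) :=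
  b14_main_leavesP_all_theta13OfThm1CCMWZH_of_supplyChainAt_family (θ := gaussPinH (Stage13HParams.ofHistoryBlind F N ⟨theta13OfThm1CCMWZ F N j γ ε₀ ε₂₉ B₃ B₃' a₀ a₁ Efl logz, Zr⟩))
    rfl hγ₀ hγh hε hε' hB hB' ha₀ ha₁ hrec
    (supplyChainAt_family_of_gaussCert_of_continuous (gaussPinH (Stage13HParams.ofHistoryBlind F N ⟨theta13OfThm1CCMWZ F N j γ ε₀ ε₂₉ B₃ B₃' a₀ a₁ Efl logz, Zr⟩))
      (gaussPinH_ζ0 _) (gaussPinH_quad _) hrec (one_le_M_stage12NumericsOfThm1CCMW F j γ ε₀ B₃ B₃' a₀ a₁) σ hσ hE hCE hR hB9 hCB) w hC hγw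

/-- **★★★ N11's CHILD FAMILY IN dag-n24-c's `h11` SHAPE AT `θᴳᶻ`'s SepCoPH DATUM ON THE OPERAND-ROWS ROAD, WINDOWED** — g4 FILE 4 §4 at the z-witness: per windowed run
[III] §3's supplier at `θᴳᶻ` with `SupplierObligations` and def-T's `OperandRowsAlongChain` (`supplyChainAt_family_of_gaussCert_of_operandRows` at the certificate, keys `rfl`);
any door proof `hG`; window `0 < γ ≤ ½` + six signs; letters NOT read; `γ₁₁ := γ′`. [cite: Balaban1988Convergent, Theorem p.245, Thm 1 p.262, remark p.262, p.244 L36–38, §3 p.279, (3.16)–(3.25) pp.268–270, (2.21) p.258, (1.15) p.249; Balaban1989LargeFieldII, Thm 1 + (0.1) pp.355–356, (0.15) p.360; Balaban1987RG1, Thm 1 p.259; Balaban1989LargeFieldI, (0.2)–(0.4) p.176] -/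
theorem h11Family_gaussPinH_ofHistoryBlind_theta13OfThm1CCMWZ_of_operandRows_windowed (hγ₀ : 0 < γ) (hγh : γ ≤ 1 / 2) (hε : 0 < ε₀) (hε' : 0 < ε₂₉)
    (hB : 0 ≤ B₃) (hB' : 0 ≤ B₃') (ha₀ : 0 < a₀) (ha₁ : 0 < a₁)
    (hG : (gaussPinH (Stage13HParams.ofHistoryBlind F N ⟨theta13OfThm1CCMWZ F N j γ ε₀ ε₂₉ B₃ B₃' a₀ a₁ Efl logz, Zr⟩)).Provisos₁₃SepCoPH F N) {γ' : ℝ} (hγ' : 0 < γ')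
    (σ : (P : B12.RunParams) → Sect3Supplier (gaussPinH (Stage13HParams.ofHistoryBlind F N ⟨theta13OfThm1CCMWZ F N j γ ε₀ ε₂₉ B₃ B₃' a₀ a₁ Efl logz, Zr⟩)) P)
    (hσ : ∀ P : B12.RunParams, Step.InInterval γ' P.K (gOfRecord₁₃ F N (theta13OfThm1CCMWZ F N j γ ε₀ ε₂₉ B₃ B₃' a₀ a₁ Efl logz) P) →
      SupplierObligations (gaussPinH (Stage13HParams.ofHistoryBlind F N ⟨theta13OfThm1CCMWZ F N j γ ε₀ ε₂₉ B₃ B₃' a₀ a₁ Efl logz, Zr⟩)) P (σ P))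
    (hops : ∀ P : B12.RunParams, Step.InInterval γ' P.K (gOfRecord₁₃ F N (theta13OfThm1CCMWZ F N j γ ε₀ ε₂₉ B₃ B₃' a₀ a₁ Efl logz) P) →
      OperandRowsAlongChain (gaussPinH (Stage13HParams.ofHistoryBlind F N ⟨theta13OfThm1CCMWZ F N j γ ε₀ ε₂₉ B₃ B₃' a₀ a₁ Efl logz, Zr⟩)) P (σ P)) :
    ∀ βup β₀ : ℝ, ∃ γ₁₁ : ℝ, 0 < γ₁₁ ∧ ∀ w : WorldP,
      w.C = (datumOfRecord₁₃SepCoPH F N (gaussPinH (Stage13HParams.ofHistoryBlind F N ⟨theta13OfThm1CCMWZ F N j γ ε₀ ε₂₉ B₃ B₃' a₀ a₁ Efl logz, Zr⟩)) hG).C →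
      w.βup = βup → w.β₀ = β₀ → w.γ ≤ γ₁₁ → ∀ P : B12.RunParams, (leavesP w P).b7 → (leavesP w P).b8 → (leavesP w P).b9 → (leavesP w P).b10 → (leavesP w P).b11 →
      (leavesP w P).smallCouplings → (leavesP w P).smallFieldInductive → (leavesP w P).flowControl →
        ∀ k, k < P.K → SLaw₁₃CoPH F N (gaussPinH (Stage13HParams.ofHistoryBlind F N ⟨theta13OfThm1CCMWZ F N j γ ε₀ ε₂₉ B₃ B₃' a₀ a₁ Efl logz, Zr⟩)) P k →
          TLaw₁₃CoPH F N (gaussPinH (Stage13HParams.ofHistoryBlind F N ⟨theta13OfThm1CCMWZ F N j γ ε₀ ε₂₉ B₃ B₃' a₀ a₁ Efl logz, Zr⟩)) P k :=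
  h11Family_gaussPinH_ofHistoryBlind_theta13OfThm1CCMWZ_of_supplyChainAt_family Zr hγ₀ hγh hε hε' hB hB' ha₀ ha₁ hG hγ'
    (supplyChainAt_family_of_gaussCert_of_operandRows (gaussPinH (Stage13HParams.ofHistoryBlind F N ⟨theta13OfThm1CCMWZ F N j γ ε₀ ε₂₉ B₃ B₃' a₀ a₁ Efl logz, Zr⟩))
      (gaussPinH_ζ0 _) (gaussPinH_quad _) hG.toCore (one_le_M_stage12NumericsOfThm1CCMW F j γ ε₀ B₃ B₃' a₀ a₁) σ hσ hops)

end CertificateZ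

/-! ## §4  Bridge (`rfl`): dag-n11-w6's certificate `θᴳ` of the BLIND witness IS the `(0, 0)` member of the z-family of certificates -/

section Bridge

variable (j : ℕ) (γ ε₀ ε₂₉ B₃ B₃' a₀ a₁ : ℝ) (Zr : (q : B12.RunParams) → TkResidualW F N (FluctV N) q.K)

/-- **BRIDGE (`rfl`): `θᴳ = θᴳᶻ(…; 0, 0)`** — the certificate of K1's coupling-blind witness is the certificate of the z-witness at the letters `Efl = logz = 0` (Z2's
`theta13OfThm1CCMW_eq_Z` under `gaussPinH ∘ ofHistoryBlind`); so g4 FILE 3 §4 ∕ FILE 4 §4 are the `(0, 0)` instances of §3. [cite: Balaban1989LargeFieldI, (0.3) p.176; Balaban1988Convergent, (1.15) p.249, (3.16) p.268; Balaban1989LargeFieldII, (0.15) p.360 (bookkeeping)] -/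
theorem gaussPinH_ofHistoryBlind_theta13OfThm1CCMW_eq_Z :
    gaussPinH (Stage13HParams.ofHistoryBlind F N ⟨theta13OfThm1CCMW F N j γ ε₀ ε₂₉ B₃ B₃' a₀ a₁, Zr⟩) =
      gaussPinH (Stage13HParams.ofHistoryBlind F N ⟨theta13OfThm1CCMWZ F N j γ ε₀ ε₂₉ B₃ B₃' a₀ a₁ (fun _ _ => 0) (fun _ _ => 0), Zr⟩) := rfl

end Bridge

end Summit.QuantumFields.YangMills.Theorems.BalabanUVNodesN11NodeFacesOfSupplyChainTokensAtZWitness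

end
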